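import Summits.PneNP.PneNP.Theorems.SymmetryBudgetWindowBarrierEntropyGamePebble

/-!
# Colour-refined pebble types and their entropy
(dichotomy `WindowBarrier` stmt-PneNP-2145 / `NoHiddenOrder` stmt-PneNP-14781, route `PneNP/SymmetryBudget`)

Bookkeeping for the colouring-robustness theorem of the entropy game
(`SymmetryBudgetWindowBarrierEntropyGameColouring.lean`): the pebble types of
`SymmetryBudgetWindowBarrierEntropyGamePebble.lean` ("`k` singletons and one block") with the one block
replaced by the classes of an arbitrary colouring `χ`.

* `CosetGame.colMu χ I` — the labelling "singletons at `I`, classes of `χ` elsewhere"; elements of its block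
  group fix the pebbled slots and preserve `χ`.
* `CosetGame.card_classStab_le_pow_mul` — refining by `|I|` singletons costs a factor `≤ n^{|I|}` in the class
  stabiliser (orbit–stabiliser on the tuple `I`); `CosetGame.isLowEntropy_colMu` — so `colMu χ I` is a type of
  the entropy-`K` game whenever `n!·n^k ≤ 2^{Kn}·|classStab χ|` and `|I| ≤ k`.
* `CosetGame.card_classStab_comp_perm` — relabelling invariance; `CosetGame.factorial_le_pow_mul_card_classStab`
  — a colouring with values `< t` has `n! ≤ tⁿ·|classStab c|`; `CosetGame.isLowEntropy_of_lt_two_pow` —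
  colourings with `≤ 2^K` colours have entropy `≤ K n`.
-/

-- `Summit.PneNP.PneNP.…` duplicates `PneNP` BY DESIGN (single-problem summit).
set_option linter.dupNamespace false

namespace Summit.PneNP.PneNP.Theorems

open Finset Filter Literature.Computability.Complexity Literature.ModelTheory.FiniteModelTheory
open scoped Classical

namespace CosetGame

variable {n K : ℕ}

noncomputable section

/-! ### Colour-refined pebble types -/

/-- The labelling "singletons at `I`, colour classes of `χ` elsewhere" (odd labels for the pebbled slots,
even labels `2 χ` for the rest). -/
def colMu (χ : Fin n → ℕ) (I : Finset (Fin n)) : Fin n → ℕ :=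
  fun i => if i ∈ I then 2 * (i : ℕ) + 1 else 2 * χ i

/-- Pebbled slots carry their own (odd) label. -/
theorem colMu_of_mem {χ : Fin n → ℕ} {I : Finset (Fin n)} {i : Fin n} (h : i ∈ I) :
    colMu χ I i = 2 * (i : ℕ) + 1 := if_pos h

/-- Unpebbled slots carry twice their colour. -/
theorem colMu_of_not_mem {χ : Fin n → ℕ} {I : Finset (Fin n)} {i : Fin n} (h : i ∉ I) :
    colMu χ I i = 2 * χ i := if_neg h

/-- Equal labels: both pebbled and equal, or both unpebbled and equally coloured. -/
theorem colMu_eq_iff {χ : Fin n → ℕ} {I : Finset (Fin n)} {i j : Fin n} :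
    colMu χ I i = colMu χ I j ↔ (i ∈ I ∧ j ∈ I ∧ i = j) ∨ (i ∉ I ∧ j ∉ I ∧ χ i = χ j) := by
  by_cases hi : i ∈ I <;> by_cases hj : j ∈ I
  · rw [colMu_of_mem hi, colMu_of_mem hj]
    constructor
    · intro h; exact Or.inl ⟨hi, hj, Fin.ext (by omega)⟩
    · rintro (⟨-, -, rfl⟩ | ⟨h, -⟩)
      · rfl
      · exact absurd hi h
  · rw [colMu_of_mem hi, colMu_of_not_mem hj]
    constructor
    · intro h; omega
    · rintro (⟨-, h, -⟩ | ⟨h, -⟩)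
      · exact absurd h hj
      · exact absurd hi h
  · rw [colMu_of_not_mem hi, colMu_of_mem hj]
    constructor
    · intro h; omega
    · rintro (⟨h, -, -⟩ | ⟨-, h, -⟩)
      · exact absurd h hi
      · exact absurd hj h
  · rw [colMu_of_not_mem hi, colMu_of_not_mem hj]
    constructor
    · intro h; exact Or.inr ⟨hi, hj, by omega⟩
    · rintro (⟨h, -, -⟩ | ⟨-, -, h⟩)
      · exact absurd h hi
      · rw [h]

/-- Label-preserving permutations fix the pebbled slots. -/
theorem apply_eq_of_mem_classStab_colMu {χ : Fin n → ℕ} {I : Finset (Fin n)} {ρ : Equiv.Perm (Fin n)}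
    (hρ : ρ ∈ classStab (colMu χ I)) {i : Fin n} (hi : i ∈ I) : ρ i = i := by
  have h := (mem_classStab_iff _ _).1 hρ i
  rcases colMu_eq_iff.1 h with ⟨-, -, h⟩ | ⟨-, h, -⟩
  · exact h
  · exact absurd hi h

/-- Label-preserving permutations preserve the colours. -/
theorem chi_apply_of_mem_classStab_colMu {χ : Fin n → ℕ} {I : Finset (Fin n)} {ρ : Equiv.Perm (Fin n)}
    (hρ : ρ ∈ classStab (colMu χ I)) (i : Fin n) : χ (ρ i) = χ i := by
  have h := (mem_classStab_iff _ _).1 hρ i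
  rcases colMu_eq_iff.1 h with ⟨-, -, h⟩ | ⟨-, -, h⟩
  · rw [h]
  · exact h

/-- Elements of the block group of a colour-refined pebble type fix the pebbled slots. -/
theorem apply_eq_of_mem_blockGroup_colMu {χ : Fin n → ℕ} {I : Finset (Fin n)} {ρ : Equiv.Perm (Fin n)}
    (hρ : ρ ∈ blockGroup (colMu χ I)) {i : Fin n} (hi : i ∈ I) : ρ i = i := by
  obtain ⟨hc, -⟩ := (mem_evenStab_iff _ _).1 (blockGroup_le_evenStab _ hρ)
  exact apply_eq_of_mem_classStab_colMu hc hi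

/-- Elements of the block group of a colour-refined pebble type preserve the colours. -/
theorem chi_apply_of_mem_blockGroup_colMu {χ : Fin n → ℕ} {I : Finset (Fin n)} {ρ : Equiv.Perm (Fin n)}
    (hρ : ρ ∈ blockGroup (colMu χ I)) (i : Fin n) : χ (ρ i) = χ i := by
  obtain ⟨hc, -⟩ := (mem_evenStab_iff _ _).1 (blockGroup_le_evenStab _ hρ)
  exact chi_apply_of_mem_classStab_colMu hc i

/-! ### Entropy bookkeeping -/

/-- **Refining a colouring by `|I|` singletons costs a factor at most `n^{|I|}`**:
`|classStab χ| ≤ n^{|I|} · |classStab (colMu χ I)|` (orbit–stabiliser on the tuple `I`). -/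
theorem card_classStab_le_pow_mul (χ : Fin n → ℕ) (I : Finset (Fin n)) :
    Nat.card (classStab χ) ≤ n ^ I.card * Nat.card (classStab (colMu χ I)) := by
  -- the class stabiliser acts on tuples indexed by `I`; stabiliser of the inclusion tuple
  let x : ↥I → Fin n := fun i => (i : Fin n)
  let S : Subgroup ↥(classStab χ) := MulAction.stabilizer (↥(classStab χ)) x
  have hidx : S.index ≤ n ^ I.card := by
    rw [MulAction.index_stabilizer]
    refine (Set.ncard_le_card _).trans ?_
    rw [Nat.card_fun, Nat.card_eq_fintype_card, Fintype.card_fin, Nat.card_eq_fintype_card,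
      Fintype.card_coe]
  have hmem : ∀ g : ↥S, ((g : ↥(classStab χ)) : Equiv.Perm (Fin n)) ∈ classStab (colMu χ I) := by
    intro g u
    have hg : ∀ i : ↥I, ((g : ↥(classStab χ)) : Equiv.Perm (Fin n)) i = i := fun i => by
      have := congrFun (MulAction.mem_stabilizer_iff.1 g.2) i
      exact this
    have hχ : ∀ v, χ (((g : ↥(classStab χ)) : Equiv.Perm (Fin n)) v) = χ v := (g : ↥(classStab χ)).2
    set σ : Equiv.Perm (Fin n) := ((g : ↥(classStab χ)) : Equiv.Perm (Fin n)) with hσ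
    by_cases hu : u ∈ I
    · rw [hg ⟨u, hu⟩]
    · have hσu : σ u ∉ I := by
        intro hin
        have h1 : σ (σ u) = σ u := hg ⟨σ u, hin⟩
        exact hu (σ.injective h1 ▸ hin)
      rw [colMu_of_not_mem hσu, colMu_of_not_mem hu, hχ u]
  have hcard : Nat.card ↥S ≤ Nat.card (classStab (colMu χ I)) := by
    refine Nat.card_le_card_of_injective (fun g => (⟨_, hmem g⟩ : ↥(classStab (colMu χ I)))) ?_
    intro g g' h
    have h' := congrArg Subtype.val h
    exact Subtype.ext (Subtype.ext h')
  calc Nat.card (classStab χ) = S.index * Nat.card ↥S := S.index_mul_card.symm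
    _ ≤ n ^ I.card * Nat.card (classStab (colMu χ I)) := Nat.mul_le_mul hidx hcard

/-- Entropy in stabiliser form: `IsLowEntropy K μ ↔ n! ≤ 2^{Kn} · |classStab μ|`. -/
theorem isLowEntropy_iff_card_classStab (μ : Fin n → ℕ) :
    IsLowEntropy K μ ↔ n.factorial ≤ 2 ^ (K * n) * Nat.card (classStab μ) := by
  unfold IsLowEntropy
  rw [card_classStab]

/-- **Colour-refined pebble types are low-entropy** as soon as `n!·n^k ≤ 2^{Kn}·|classStab χ|` and
`|I| ≤ k`. -/
theorem isLowEntropy_colMu {χ : Fin n → ℕ} {k : ℕ}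
    (h : n.factorial * n ^ k ≤ 2 ^ (K * n) * Nat.card (classStab χ)) {I : Finset (Fin n)} (hI : I.card ≤ k) :
    IsLowEntropy K (colMu χ I) := by
  rw [isLowEntropy_iff_card_classStab]
  rcases Nat.eq_zero_or_pos n with hn | hn
  · subst hn
    have : 0 < Nat.card (classStab (colMu χ I)) := Nat.card_pos
    simp only [Nat.factorial_zero, mul_zero, pow_zero, one_mul]
    exact this
  · have hpow : 0 < n ^ k := pow_pos hn k
    refine Nat.le_of_mul_le_mul_right ?_ hpow
    calc n.factorial * n ^ k ≤ 2 ^ (K * n) * Nat.card (classStab χ) := h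
      _ ≤ 2 ^ (K * n) * (n ^ I.card * Nat.card (classStab (colMu χ I))) :=
          Nat.mul_le_mul_left _ (card_classStab_le_pow_mul χ I)
      _ ≤ 2 ^ (K * n) * (n ^ k * Nat.card (classStab (colMu χ I))) :=
          Nat.mul_le_mul_left _ (Nat.mul_le_mul_right _ (Nat.pow_le_pow_right hn hI))
      _ = 2 ^ (K * n) * Nat.card (classStab (colMu χ I)) * n ^ k := by ring

/-- Relabelling the points does not change the size of the class stabiliser (conjugation by `β`). -/
theorem card_classStab_comp_perm (c : Fin n → ℕ) (β : Equiv.Perm (Fin n)) :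
    Nat.card (classStab fun i => c (β i)) = Nat.card (classStab c) := by
  refine Nat.card_congr
    { toFun := fun g => ⟨β * (g : Equiv.Perm (Fin n)) * β⁻¹, fun u => ?_⟩
      invFun := fun g => ⟨β⁻¹ * (g : Equiv.Perm (Fin n)) * β, fun u => ?_⟩
      left_inv := fun g => Subtype.ext (by simp [mul_assoc])
      right_inv := fun g => Subtype.ext (by simp [mul_assoc]) }
  · have h : c (β ((g : Equiv.Perm (Fin n)) (β⁻¹ u))) = c (β (β⁻¹ u)) := g.2 (β⁻¹ u)
    simp only [Equiv.Perm.coe_inv, Equiv.apply_symm_apply] at h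
    simp only [Equiv.Perm.mul_apply, Equiv.Perm.coe_inv]
    exact h
  · have h : c ((g : Equiv.Perm (Fin n)) (β u)) = c (β u) := g.2 (β u)
    show c (β ((β⁻¹ * (g : Equiv.Perm (Fin n)) * β) u)) = c (β u)
    simp only [Equiv.Perm.mul_apply, Equiv.Perm.coe_inv, Equiv.apply_symm_apply]
    exact h

/-- **Few colours, low entropy**: a colouring with values `< t` has `n! ≤ tⁿ · |classStab c|`
(the index of the class stabiliser is the number of rearrangements of `c`, at most `tⁿ`). -/
theorem factorial_le_pow_mul_card_classStab (c : Fin n → ℕ) (t : ℕ) (hc : ∀ u, c u < t) :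
    n.factorial ≤ t ^ n * Nat.card (classStab c) := by
  have hidx : (classStab c).index ≤ t ^ n := by
    unfold Subgroup.index
    let f : Equiv.Perm (Fin n) ⧸ classStab c → (Fin n → Fin t) :=
      fun q u => ⟨c (q.out⁻¹ u), hc _⟩
    have hf : Function.Injective f := by
      intro q₁ q₂ h
      have h' : ∀ u, c (q₁.out⁻¹ u) = c (q₂.out⁻¹ u) := fun u => by
        have := congrFun h u
        exact Fin.mk.inj_iff.1 this
      have hmem : q₁.out⁻¹ * q₂.out ∈ classStab c := by
        intro u
        rw [Equiv.Perm.mul_apply, h' (q₂.out u)]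
        simp only [Equiv.Perm.coe_inv, Equiv.symm_apply_apply]
      rw [← QuotientGroup.out_eq' q₁, ← QuotientGroup.out_eq' q₂]
      exact QuotientGroup.eq.2 hmem
    refine (Nat.card_le_card_of_injective f hf).trans ?_
    rw [Nat.card_fun, Nat.card_eq_fintype_card, Fintype.card_fin, Nat.card_eq_fintype_card, Fintype.card_fin]
  have h := (classStab c).index_mul_card
  rw [Nat.card_perm, Nat.card_eq_fintype_card (α := Fin n), Fintype.card_fin] at h
  rw [← h]
  exact Nat.mul_le_mul_right _ hidx

/-- Colourings with at most `2^K` colours (values `< 2^K`) have entropy `≤ K n`. -/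
theorem isLowEntropy_of_lt_two_pow {c : Fin n → ℕ} (hc : ∀ u, c u < 2 ^ K) : IsLowEntropy K c := by
  rw [isLowEntropy_iff_card_classStab]
  have h := factorial_le_pow_mul_card_classStab c (2 ^ K) hc
  rwa [← pow_mul] at h


end

end CosetGame

end Summit.PneNP.PneNP.Theorems
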